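import Mathlib.RingTheory.MvPolynomial.Homogeneous
import Mathlib.RingTheory.MvPolynomial.EulerIdentity
import Mathlib.Algebra.MvPolynomial.PDeriv
import Mathlib.LinearAlgebra.Matrix.Determinant.Basic
import Mathlib.Data.Matrix.Block
import HarnessLib

/-!
# [OURS · L1 W4.5(b) · EL♮(3) · nose residue, door ν4 «EQUINODAL PLANAR NOSE», brick (D6-1) file B]
# The MARKED-NODE RELATION FAMILY of a ternary form and its JACOBI BLOCK at the special point

Cell `res-hironaka`, LADDER-RESOLUTION rung L (D-0089), slot W4.5(b), crux chain w45b: child crux **EL♮(3)** =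
stmt-ResolutionOfSingularities-20148 (parent EL♮ = stmt-…-20038); registered nose residue of record
`stub_elnat_three_nonisolated_nonUnobsNonHostedNestNoseBTriplePrime` (39th registration, CHILD v45 d73c58dccb65cdf1).
WIDTH seat res-L1-w45b-nose-w1 g3 (D-0157 DOOR 1), desk RULING R52 / WIDTH TABLE D6 row **(D6-1)**: the (S1) supplier
`exists_equinodal_lift` of NU4-SIZING v5 f7486aab0e6e06a9 (§0 (S1) (m1)–(m5), §M M.2 (a); mechanism idea-3 MEMO g14 §N-C′,
door idea-2 R11-6/R15). This is file B of three = items (m1)–(m2): the explicit relation family and its Jacobian at the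
special point. `--supports stmt-ResolutionOfSingularities-20148 --as helper`, counted 0.
OURS; NOT a statement of H. Hironaka's 2017 manuscript (nothing of [Hironaka2017] is asserted); AI-written, AI review
weaker than expert review. Small `def`s (the system and its bookkeeping), no `sorry`, standard axioms. EL♮(3) is NOT
proved here; resolution in positive characteristic is NOT proved here (dimension 3 is Cossart–Piltant 2008/2009).

WHAT. For a ternary polynomial `g₀ ∈ R[x₀,x₁,x₂]` and `δ` pivot exponent vectors `m j`, the SQUARE polynomial system
`nodeSystem g₀ m : Idx δ → R[X_c : c ∈ Idx δ]`, `Idx δ = Fin δ ⊕ (Fin 2 × Fin δ)`: unknowns `X (inl j)` = a correction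
`u_j` to the coefficient of `x^(m j)`, `X (inr (r, i))` = the `r`-th affine coordinate of the `i`-th marked point in
the chart `x₂ = 1`; relations: row `inl i` = the value of `g₀ + Σ_j u_j x^(m j)` at the `i`-th marked point, row
`inr (r, i)` = the value of its `r`-th partial there (`r = 0, 1`). Lemmas: change of coefficients (`map_nodeSystem`),
semantics (`eval_nodeSystem`: row = `op row (formOf g₀ m u)` at `nd w i`), the special point `spt n̄ = (0, n̄)` is a
root when `g₀, ∂₀g₀, ∂₁g₀` vanish at the marked points (`eval_spt_nodeSystem`), the Jacobi matrix entries there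
(`jac_inl`, `jac_inr_of_ne`, `jac_inr_self`) and **`det_jacobian`**: with `∇g₀ = 0` at the marked points the Jacobi
matrix is `Matrix.fromBlocks M 0 C (Matrix.blockDiagonal Hess)`, `M i j = x^(m j)(n̄ i)` the evaluation matrix of the
pivot monomials, `Hess i` the affine `2 × 2` Hessian at `n̄ i`, so `det = det M · ∏ᵢ (H₀₀H₁₁ − H₀₁²)(n̄ i)`
(`Matrix.det_fromBlocks_zero₁₂`, `Matrix.det_blockDiagonal`, `Matrix.det_fin_two`, symmetry of mixed partials
`pderiv_pderiv_comm`). Also the chain rule `pderiv_aeval_eq_sum` for substitutions with constant coefficients.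
File C (`…NatEquinodalLift`) feeds this determinant to file A's square Hensel lemma (`…NatSquareHensel`).

References (index only): mechanism = the classical «nodes impose independent conditions» / equisingular-deformation
Jacobian, e.g. Greuel–Lossen–Shustin, *Introduction to Singularities and Deformations* (2007) II.2; here only
elementary polynomial calculus is used. [folklore]
-/

set_option linter.dupNamespace false

noncomputable section

open MvPolynomial

namespace Summit.ResolutionOfSingularities.ResolutionOfSingularities.Cruxes.EquisingularLiftNat.Sections.Equinodal

variable {R : Type*} [CommRing R] {δ : ℕ}

/-- **Chain rule for a partial derivative of a substitution** `p(f₁, …, f_σ)` with CONSTANT coefficients: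
`∂_c p(f) = Σ_s (∂_s p)(f) · ∂_c f_s`. [folklore] -/
theorem pderiv_aeval_eq_sum {σ τ : Type*} [Fintype σ] [DecidableEq σ] [DecidableEq τ]
    (f : σ → MvPolynomial τ R) (p : MvPolynomial σ R) (c : τ) :
    pderiv c (aeval f p) = ∑ s, aeval f (pderiv s p) * pderiv c (f s) := by
  induction p using MvPolynomial.induction_on with
  | C a => simp
  | add p q hp hq => simp only [map_add, hp, hq, add_mul, Finset.sum_add_distrib]
  | mul_X p s hp =>
    have hX : ∀ t, aeval f (pderiv t (p * X s)) * pderiv c (f t) =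
        f s * (aeval f (pderiv t p) * pderiv c (f t)) + (if s = t then aeval f p * pderiv c (f t) else 0) := by
      intro t
      rw [Derivation.leibniz, pderiv_X, smul_eq_mul, smul_eq_mul, map_add, map_mul, map_mul, aeval_X,
        Pi.single_apply]
      split_ifs with h
      · subst h; simp; ring
      · simp; ring
    rw [map_mul, aeval_X, Derivation.leibniz, smul_eq_mul, smul_eq_mul, hp]
    simp_rw [hX, Finset.sum_add_distrib, Finset.sum_ite_eq, Finset.mem_univ, if_true, ← Finset.mul_sum]
    ring

/-- Partial derivatives of polynomials commute. [folklore] -/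
theorem pderiv_pderiv_comm {σ : Type*} (s t : σ) (p : MvPolynomial σ R) :
    pderiv s (pderiv t p) = pderiv t (pderiv s p) := by
  classical
  ext d
  simp only [coeff_pderiv]
  rw [add_right_comm d (Finsupp.single s 1) (Finsupp.single t 1)]
  simp only [Finsupp.coe_add, Pi.add_apply, Finsupp.single_apply]
  by_cases h : s = t
  · subst h; ring
  · simp [h, Ne.symm h]; ring

/-- `∂_c X_j` is the constant `[j = c]`. -/
theorem pderiv_X_eq_C {τ : Type*} [DecidableEq τ] (c j : τ) :
    pderiv c (X j : MvPolynomial τ R) = C (if j = c then 1 else 0) := by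
  rw [pderiv_X, Pi.single_apply]
  split_ifs <;> simp

/-- Index type of the square marked-node system: `inl j` = the correction to the coefficient of the `j`-th pivot monomial,
`inr (r, i)` = the `r`-th affine coordinate (`r = 0, 1`; chart `x₂ = 1`) of the `i`-th marked point. [OURS] -/
abbrev Idx (δ : ℕ) : Type := Fin δ ⊕ (Fin 2 × Fin δ)

/-- the marked point a row/column index belongs to. [OURS] -/
def nodeOf : Idx δ → Fin δ := Sum.elim id Prod.snd

/-- the symbolic coordinate vector of the `i`-th marked point in the chart `x₂ = 1`. [OURS] -/
def pt (R : Type*) [CommRing R] (i : Fin δ) : Fin 3 → MvPolynomial (Idx δ) R :=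
  ![X (Sum.inr (0, i)), X (Sum.inr (1, i)), 1]

/-- the operator of a row: the VALUE (`inl`) or the PARTIAL `∂/∂x_r` (`inr (r, _)`), as an `R`-linear map. [OURS] -/
def op (R : Type*) [CommRing R] : Idx δ → (MvPolynomial (Fin 3) R →ₗ[R] MvPolynomial (Fin 3) R)
  | Sum.inl _ => LinearMap.id
  | Sum.inr ri => (pderiv (Fin.castSucc ri.1) : Derivation R (MvPolynomial (Fin 3) R) _).toLinearMap

/-- **The square marked-node system** of the ternary form `g₀ + Σ_j u_j · x^(m j)` (non-pivot coefficients FROZEN in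
`g₀`, the pivot coefficients corrected by the unknowns `u_j = X (inl j)`): row `inl i` = its value at the `i`-th marked
point `(X (inr (0,i)), X (inr (1,i)), 1)`, row `inr (r, i)` = the value of its `r`-th partial there. [OURS] -/
def nodeSystem (g₀ : MvPolynomial (Fin 3) R) (m : Fin δ → (Fin 3 →₀ ℕ)) (row : Idx δ) :
    MvPolynomial (Idx δ) R :=
  aeval (pt R (nodeOf row)) (op R row g₀) +
    ∑ j, X (Sum.inl j) * aeval (pt R (nodeOf row)) (op R row (monomial (m j) 1))

/-- the ternary form with pivot coefficients corrected by `u`. [OURS] -/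
def formOf (g₀ : MvPolynomial (Fin 3) R) (m : Fin δ → (Fin 3 →₀ ℕ)) (u : Fin δ → R) :
    MvPolynomial (Fin 3) R :=
  g₀ + ∑ j, C (u j) * monomial (m j) 1

/-- the coordinate vector of the `i`-th marked point at a point `w` of the unknowns (chart `x₂ = 1`). [OURS] -/
def nd (w : Idx δ → R) (i : Fin δ) : Fin 3 → R := ![w (Sum.inr (0, i)), w (Sum.inr (1, i)), 1]

/-- the point of the unknowns with all coefficient corrections `0` and marked points `nbar` (their `x₂`-coordinate,
assumed `1`, is dropped). [OURS] -/
def spt (nbar : Fin δ → Fin 3 → R) : Idx δ → R :=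
  Sum.elim (fun _ => 0) (fun ri => nbar ri.2 (Fin.castSucc ri.1))

omit [CommRing R] in
/-- a value row/column belongs to its own marked point. -/
theorem nodeOf_inl (i : Fin δ) : nodeOf (Sum.inl i : Idx δ) = i := rfl

omit [CommRing R] in
/-- a gradient row / coordinate column belongs to its marked point. -/
theorem nodeOf_inr (r : Fin 2) (i : Fin δ) : nodeOf (Sum.inr (r, i) : Idx δ) = i := rfl

/-- the operator of a value row is the identity. -/
theorem op_inl_apply (j : Fin δ) (p : MvPolynomial (Fin 3) R) : op R (Sum.inl j) p = p := rfl

/-- the operator of a gradient row is the partial derivative `∂/∂x_r`. -/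
theorem op_inr_apply (r : Fin 2) (i : Fin δ) (p : MvPolynomial (Fin 3) R) :
    op R (Sum.inr (r, i)) p = pderiv (Fin.castSucc r) p := rfl

/-- at the special point every coefficient correction is `0`. -/
theorem spt_inl (nbar : Fin δ → Fin 3 → R) (j : Fin δ) : spt nbar (Sum.inl j) = 0 := rfl

/-- `op` commutes with `C c * ·`. -/
theorem op_C_mul (row : Idx δ) (c : R) (p : MvPolynomial (Fin 3) R) :
    op R row (C c * p) = C c * op R row p := by
  rw [C_mul', C_mul', LinearMap.map_smul]

/-- `op` commutes with a change of coefficient ring. -/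
theorem map_op {S : Type*} [CommRing S] (φ : R →+* S) (row : Idx δ) (p : MvPolynomial (Fin 3) R) :
    map φ (op R row p) = op S row (map φ p) := by
  rcases row with j | ⟨r, i⟩
  · rfl
  · simp [op_inr_apply, pderiv_map]

/-- `op` commutes with a further partial derivative. -/
theorem pderiv_op (row : Idx δ) (s : Fin 3) (p : MvPolynomial (Fin 3) R) :
    pderiv s (op R row p) = op R row (pderiv s p) := by
  rcases row with j | ⟨r, i⟩
  · rfl
  · simp only [op_inr_apply, pderiv_pderiv_comm]

/-- the symbolic marked point is compatible with a change of coefficients. -/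
theorem map_pt {S : Type*} [CommRing S] (φ : R →+* S) (i : Fin δ) (s : Fin 3) :
    map φ (pt R i s) = pt S i s := by
  fin_cases s
  · simp [pt]
  · simp [pt]
  · simp [pt]

/-- `map` commutes with the substitution of the symbolic marked point. -/
theorem map_aeval_pt {S : Type*} [CommRing S] (φ : R →+* S) (i : Fin δ) (p : MvPolynomial (Fin 3) R) :
    map φ (aeval (pt R i) p) = aeval (pt S i) (map φ p) := by
  have h := MvPolynomial.ringHom_ext (f := (map φ).comp (aeval (pt R i)).toRingHom)
    (g := (aeval (pt S i)).toRingHom.comp (map φ)) (fun a => by simp) (fun s => by simp [map_pt])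
  exact RingHom.congr_fun h p

/-- The system commutes with a change of coefficient ring. -/
theorem map_nodeSystem {S : Type*} [CommRing S] (φ : R →+* S) (g₀ : MvPolynomial (Fin 3) R)
    (m : Fin δ → (Fin 3 →₀ ℕ)) (row : Idx δ) :
    map φ (nodeSystem g₀ m row) = nodeSystem (map φ g₀) m row := by
  simp only [nodeSystem, map_add, map_sum, map_mul, map_X, map_aeval_pt, map_op, map_monomial, map_one]

/-- the evaluation `eval w ∘ pt i` is the coordinate vector `nd w i`. -/
theorem eval_pt (w : Idx δ → R) (i : Fin δ) (s : Fin 3) : eval w (pt R i s) = nd w i s := by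
  fin_cases s
  · simp [pt, nd]
  · simp [pt, nd]
  · simp [pt, nd]

/-- evaluating a substituted ternary polynomial at `w` = evaluating it at the marked vector `nd w i`. -/
theorem eval_aeval_pt (w : Idx δ → R) (i : Fin δ) (p : MvPolynomial (Fin 3) R) :
    eval w (aeval (pt R i) p) = eval (nd w i) p := by
  induction p using MvPolynomial.induction_on with
  | C a => simp
  | add p q hp hq => simp only [map_add, hp, hq]
  | mul_X p s hp => simp only [map_mul, aeval_X, hp, eval_pt, eval_X]

/-- **Semantics of the system**: at a point `w` of the unknowns, row `row` evaluates to `op row` of the corrected form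
`formOf g₀ m (w ∘ inl)` at the marked point `nd w (nodeOf row)`. -/
theorem eval_nodeSystem (g₀ : MvPolynomial (Fin 3) R) (m : Fin δ → (Fin 3 →₀ ℕ)) (w : Idx δ → R) (row : Idx δ) :
    eval w (nodeSystem g₀ m row) =
      eval (nd w (nodeOf row)) (op R row (formOf g₀ m (fun j => w (Sum.inl j)))) := by
  simp only [nodeSystem, formOf, map_add, map_sum, map_mul, eval_X, eval_aeval_pt, op_C_mul, eval_C]

/-- At the special point `spt nbar` the corrected form is `g₀` itself. -/
theorem formOf_spt (g₀ : MvPolynomial (Fin 3) R) (m : Fin δ → (Fin 3 →₀ ℕ)) (nbar : Fin δ → Fin 3 → R) :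
    formOf g₀ m (fun j => spt nbar (Sum.inl j)) = g₀ := by
  simp [formOf, spt_inl]

/-- at the special point the marked vectors are the marked points (chart `x₂ = 1`). -/
theorem nd_spt (nbar : Fin δ → Fin 3 → R) (hchart : ∀ i, nbar i 2 = 1) (i : Fin δ) :
    nd (spt nbar) i = nbar i := by
  ext s
  fin_cases s
  · simp [nd, spt]
  · simp [nd, spt]
  · simp [nd, hchart i]

/-- **The special point is an exact root downstairs**: if `g₀` and its two chart partials vanish at the marked points,
every row of the system vanishes at `spt nbar`. -/
theorem eval_spt_nodeSystem (g₀ : MvPolynomial (Fin 3) R) (m : Fin δ → (Fin 3 →₀ ℕ))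
    (nbar : Fin δ → Fin 3 → R) (hchart : ∀ i, nbar i 2 = 1)
    (hnode : ∀ i, eval (nbar i) g₀ = 0 ∧ ∀ j, eval (nbar i) (pderiv j g₀) = 0) (row : Idx δ) :
    eval (spt nbar) (nodeSystem g₀ m row) = 0 := by
  rw [eval_nodeSystem, formOf_spt, nd_spt nbar hchart]
  rcases row with i | ⟨r, i⟩
  · exact (hnode i).1
  · exact (hnode i).2 _

/-- the symbolic marked point does not involve the coefficient unknowns. -/
theorem pderiv_inl_pt (j : Fin δ) (i : Fin δ) (s : Fin 3) :
    pderiv (Sum.inl j : Idx δ) (pt R i s) = 0 := by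
  classical
  fin_cases s
  · simp [pt]
  · simp [pt]
  · simp [pt]

/-- moving a coordinate of ANOTHER marked point does not move this one. -/
theorem pderiv_inr_pt_of_ne (r' : Fin 2) {i i' : Fin δ} (h : i ≠ i') (s : Fin 3) :
    pderiv (Sum.inr (r', i') : Idx δ) (pt R i s) = 0 := by
  classical
  fin_cases s
  · simp [pt, h]
  · simp [pt, h]
  · simp [pt]

/-- moving the `r'`-th coordinate of THIS marked point. -/
theorem pderiv_inr_pt_self (r' : Fin 2) (i : Fin δ) (s : Fin 3) :
    pderiv (Sum.inr (r', i) : Idx δ) (pt R i s) = C (if s = Fin.castSucc r' then 1 else 0) := by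
  classical
  fin_cases s <;> fin_cases r' <;> simp [pt]

/-- **Jacobi matrix of the system at the special point, column `inl j`** (moving the `j`-th pivot coefficient):
the entry is `op row (x^(m j))` evaluated at the marked point. -/
theorem jac_inl (g₀ : MvPolynomial (Fin 3) R) (m : Fin δ → (Fin 3 →₀ ℕ))
    (nbar : Fin δ → Fin 3 → R) (hchart : ∀ i, nbar i 2 = 1) (row : Idx δ) (j : Fin δ) :
    eval (spt nbar) (pderiv (Sum.inl j) (nodeSystem g₀ m row)) =
      eval (nbar (nodeOf row)) (op R row (monomial (m j) 1)) := by
  classical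
  simp only [nodeSystem, map_add, map_sum, Derivation.leibniz, smul_eq_mul, pderiv_aeval_eq_sum,
    pderiv_inl_pt, mul_zero, Finset.sum_const_zero, zero_add, map_mul,
    eval_aeval_pt, nd_spt nbar hchart, pderiv_X_eq_C, eval_C, Sum.inl.injEq]
  rw [Finset.sum_eq_single j]
  · simp
  · intro b _ hb; simp [hb]
  · intro h; exact absurd (Finset.mem_univ j) h

/-- **Jacobi matrix of the system at the special point, column `inr (r', i')`, off the row's marked point**: zero. -/
theorem jac_inr_of_ne (g₀ : MvPolynomial (Fin 3) R) (m : Fin δ → (Fin 3 →₀ ℕ))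
    (nbar : Fin δ → Fin 3 → R) (row : Idx δ) (r' : Fin 2) {i' : Fin δ} (h : nodeOf row ≠ i') :
    eval (spt nbar) (pderiv (Sum.inr (r', i')) (nodeSystem g₀ m row)) = 0 := by
  classical
  simp only [nodeSystem, map_add, map_sum, Derivation.leibniz, smul_eq_mul, pderiv_aeval_eq_sum,
    pderiv_inr_pt_of_ne r' h, mul_zero, Finset.sum_const_zero, zero_add, map_mul,
    pderiv_X_eq_C, eval_C, reduceCtorEq, if_false]

/-- **Jacobi matrix of the system at the special point, column `inr (r', i)` on the row's marked point `i`**: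
`∂_{r'} (op row g₀)` evaluated there. -/
theorem jac_inr_self (g₀ : MvPolynomial (Fin 3) R) (m : Fin δ → (Fin 3 →₀ ℕ))
    (nbar : Fin δ → Fin 3 → R) (hchart : ∀ i, nbar i 2 = 1) (row : Idx δ) (r' : Fin 2) :
    eval (spt nbar) (pderiv (Sum.inr (r', nodeOf row)) (nodeSystem g₀ m row)) =
      eval (nbar (nodeOf row)) (pderiv (Fin.castSucc r') (op R row g₀)) := by
  classical
  simp only [nodeSystem, map_add, map_sum, Derivation.leibniz, smul_eq_mul, pderiv_aeval_eq_sum,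
    pderiv_inr_pt_self, map_mul, eval_X, spt_inl, zero_mul, eval_aeval_pt, nd_spt nbar hchart,
    pderiv_X_eq_C, eval_C, reduceCtorEq, if_false, mul_zero, add_zero, Finset.sum_const_zero, mul_ite, mul_one]
  rw [Finset.sum_ite_eq' Finset.univ (Fin.castSucc r')]
  simp

/-- **The Jacobi block of the marked-node system at the special point is block-triangular**: with the gradient of `g₀`
vanishing at the marked points (chart partials `∂₀, ∂₁`), its determinant is
`det (evaluation matrix of the pivot monomials) · ∏ᵢ (H₀₀ H₁₁ − H₀₁²)(marked point i)` —
rows/columns `inl` first (`Matrix.fromBlocks`), the `inr` block being `Matrix.blockDiagonal` of the affine Hessians. -/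
theorem det_jacobian (g₀ : MvPolynomial (Fin 3) R) (m : Fin δ → (Fin 3 →₀ ℕ))
    (nbar : Fin δ → Fin 3 → R) (hchart : ∀ i, nbar i 2 = 1)
    (hgrad : ∀ i (r : Fin 2), eval (nbar i) (pderiv (Fin.castSucc r) g₀) = 0) :
    (Matrix.of fun row col : Idx δ => eval (spt nbar) (pderiv col (nodeSystem g₀ m row))).det =
      (Matrix.of fun i j : Fin δ => eval (nbar i) (monomial (m j) (1 : R))).det *
        ∏ i, (eval (nbar i) (pderiv 0 (pderiv 0 g₀)) * eval (nbar i) (pderiv 1 (pderiv 1 g₀))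
          - eval (nbar i) (pderiv 0 (pderiv 1 g₀)) ^ 2) := by
  classical
  set J : Matrix (Idx δ) (Idx δ) R :=
    Matrix.of fun row col : Idx δ => eval (spt nbar) (pderiv col (nodeSystem g₀ m row)) with hJ
  have h11 : J.toBlocks₁₁ = Matrix.of fun i j : Fin δ => eval (nbar i) (monomial (m j) (1 : R)) := by
    ext i j
    simp only [hJ, Matrix.toBlocks₁₁, Matrix.of_apply, jac_inl g₀ m nbar hchart, nodeOf_inl, op_inl_apply]
  have h12 : J.toBlocks₁₂ = 0 := by
    ext i ⟨r', i'⟩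
    simp only [hJ, Matrix.toBlocks₁₂, Matrix.of_apply, Matrix.zero_apply]
    by_cases h : i = i'
    · subst h
      rw [show (Sum.inr (r', i) : Idx δ) = Sum.inr (r', nodeOf (Sum.inl i : Idx δ)) from rfl,
        jac_inr_self g₀ m nbar hchart, nodeOf_inl, op_inl_apply, hgrad]
    · exact jac_inr_of_ne g₀ m nbar _ r' h
  have h22 : J.toBlocks₂₂ = Matrix.blockDiagonal fun i : Fin δ =>
      Matrix.of fun r r' : Fin 2 =>
        eval (nbar i) (pderiv (Fin.castSucc r') (pderiv (Fin.castSucc r) g₀)) := by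
    ext ⟨r, i⟩ ⟨r', i'⟩
    simp only [hJ, Matrix.toBlocks₂₂, Matrix.of_apply, Matrix.blockDiagonal_apply']
    by_cases h : i = i'
    · subst h
      rw [if_pos rfl, show (Sum.inr (r', i) : Idx δ) = Sum.inr (r', nodeOf (Sum.inr (r, i) : Idx δ)) from rfl,
        jac_inr_self g₀ m nbar hchart, nodeOf_inr, op_inr_apply]
    · rw [if_neg h]
      exact jac_inr_of_ne g₀ m nbar _ r' h
  rw [← Matrix.fromBlocks_toBlocks J, h11, h12, h22, Matrix.det_fromBlocks_zero₁₂, Matrix.det_blockDiagonal]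
  congr 1
  refine Finset.prod_congr rfl fun i _ => ?_
  rw [Matrix.det_fin_two]
  simp only [Matrix.of_apply, Fin.castSucc_zero, Fin.castSucc_one]
  rw [pderiv_pderiv_comm (1 : Fin 3) (0 : Fin 3) g₀]
  ring

end Summit.ResolutionOfSingularities.ResolutionOfSingularities.Cruxes.EquisingularLiftNat.Sections.Equinodal
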